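import Mathlib
import Summits.Ventures.PercRepro2.Defs
import Summits.Ventures.PercRepro2.Independence
import Summits.Ventures.PercRepro2.Harris
import Summits.Ventures.PercRepro2.Graph
import Summits.Ventures.PercRepro2.Exploration
import Summits.Ventures.PercRepro2.Induced
import Summits.Ventures.PercRepro2.R1Rung

/-!
# (CC2): the quantitative fibre-BHK with two avoided sets (blind cell PercRepro2, typer-1;
mine-c g2 `MINE-C.md` v2.2 §9.7 (1), post 2026-08-23T08:58:25Z)

For a root `s`, avoided sets `X, Y` (events `R_S = {s ↮ S}` = `avoidAll ends s S`), target sets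
`A, B` (events `{A ⊆ C(s)}` = `connAll ends s A`), and an edge `e` with the pinned weights `p[e ↦ 1]`
(index `1`) and `p[e ↦ 0]` (index `0`), with the masses `P^S = P(R_S)`, `F^S_A = P(A ⊆ C(s), R_S)`:

* **`CC2`** (mine-c's inductive candidate for the first rung):
  `F^{X∩Y}_{A∪B,1} (P^{X∪Y}_0)² + F^X_{A,0} F^Y_{B,0} P^{X∪Y}_1 ≥ P^{X∪Y}_0 (F^X_{A,1} F^Y_{B,0} + F^X_{A,0} F^Y_{B,1})`
  — BHK's four-term shape (`A ∩ B`-targets on the intersection of the avoided sets, the product on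
  their union) with exactly ONE copy carrying `e` open; closure `CC2_all`;
* `CC2_diag` (the diagonal `X = Y = T`, "(CC-T)"), and the bridge **`R1Same_iff_CC2`**: mine-c's
  same-cluster first rung `R1Same` at `(o, a₁, a₂, b)` is `CC2` at `s = a₁`, `X = Y = {a₂}`,
  `A = {b}`, `B = {o}`;
* `CC2_iff_bernstein`: `CC2 ↔ P^{X∪Y}_1 · c₀ ≤ P^{X∪Y}_0 · c_mix` with `c₀` the BHK slack on `G − e`
  and `c_mix` the mixed base (mine-c's "quantitative fibre-BHK").

Census (mine-c, exact): `n = 5` exhaustive (every graph × 3 weight vectors × every edge × every root ×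
all `|X|, |Y| ≤ 2` × all `a, b`) 0 / 2,321,280. Statement only.
-/

namespace Summit.Ventures.PercRepro2

namespace TwoSetRung

section Defs

variable {V : Type*} {E : Type*} [Fintype E] [DecidableEq E] {R : Type*} [CommRing R]

/-- `P^S = P(R_S) = P(s ↮ S)`. -/
noncomputable def massP (p : E → R) (ends : E → Sym2 V) (s : V) (S : Finset V) : R :=
  prob p (avoidAll ends s S)

/-- `F^S_A = P(A ⊆ C(s), R_S)`. -/
noncomputable def massF (p : E → R) (ends : E → Sym2 V) (s : V) (A S : Finset V) : R :=
  prob p (avoidAll ends s S ∩ connAll ends s A)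

/-- The BHK slack on `G − e`: `c₀ = F^{X∩Y}_{A∪B,0} P^{X∪Y}_0 − F^X_{A,0} F^Y_{B,0}`. -/
noncomputable def c0 [DecidableEq V] (p : E → R) (ends : E → Sym2 V) (e : E) (s : V)
    (A B X Y : Finset V) : R :=
  massF (Function.update p e 0) ends s (A ∪ B) (X ∩ Y) * massP (Function.update p e 0) ends s (X ∪ Y) -
    massF (Function.update p e 0) ends s A X * massF (Function.update p e 0) ends s B Y

/-- The mixed base: `c_mix = F^{X∩Y}_{A∪B,0} P^{X∪Y}_1 + F^{X∩Y}_{A∪B,1} P^{X∪Y}_0 − F^X_{A,0} F^Y_{B,1} − F^X_{A,1} F^Y_{B,0}`. -/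
noncomputable def cmix [DecidableEq V] (p : E → R) (ends : E → Sym2 V) (e : E) (s : V)
    (A B X Y : Finset V) : R :=
  massF (Function.update p e 0) ends s (A ∪ B) (X ∩ Y) * massP (Function.update p e 1) ends s (X ∪ Y) +
    massF (Function.update p e 1) ends s (A ∪ B) (X ∩ Y) *
      massP (Function.update p e 0) ends s (X ∪ Y) -
    massF (Function.update p e 0) ends s A X * massF (Function.update p e 1) ends s B Y -
    massF (Function.update p e 1) ends s A X * massF (Function.update p e 0) ends s B Y

end Defs

section Rows

variable {V : Type*} {E : Type*} [Fintype E] [DecidableEq E] [DecidableEq V] {R : Type*} [Field R]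
  [LinearOrder R]

/-- **(CC2)** at the edge `e` (mine-c §9.7 (1)):
`F^{X∩Y}_{A∪B,1} (P^{X∪Y}_0)² + F^X_{A,0} F^Y_{B,0} P^{X∪Y}_1 ≥ P^{X∪Y}_0 (F^X_{A,1} F^Y_{B,0} + F^X_{A,0} F^Y_{B,1})`. -/
def CC2 (p : E → R) (ends : E → Sym2 V) (e : E) (s : V) (A B X Y : Finset V) : Prop :=
  massP (Function.update p e 0) ends s (X ∪ Y) *
      (massF (Function.update p e 1) ends s A X * massF (Function.update p e 0) ends s B Y +
        massF (Function.update p e 0) ends s A X * massF (Function.update p e 1) ends s B Y) ≤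
    massF (Function.update p e 1) ends s (A ∪ B) (X ∩ Y) *
        massP (Function.update p e 0) ends s (X ∪ Y) ^ 2 +
      massF (Function.update p e 0) ends s A X * massF (Function.update p e 0) ends s B Y *
        massP (Function.update p e 1) ends s (X ∪ Y)

/-- The diagonal `X = Y = T` ("(CC-T)": EDM for the cross-centred BHK 1.3 at every avoided set). -/
def CC2_diag (p : E → R) (ends : E → Sym2 V) (e : E) (s : V) (A B T : Finset V) : Prop :=
  CC2 p ends e s A B T T

end Rows

section Closure

variable (R : Type*) [Field R] [LinearOrder R] [IsStrictOrderedRing R]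

/-- Row (CC2) over all finite graphs, admissible weights, edges, roots and set pairs. -/
def CC2_all : Prop :=
  ∀ (V E : Type) [Fintype V] [DecidableEq V] [Fintype E] [DecidableEq E]
    (ends : E → Sym2 V) (p : E → R), IsProbVec p →
    ∀ (e : E) (s : V) (A B X Y : Finset V), s ∉ X → s ∉ Y → CC2 p ends e s A B X Y

end Closure

/-! ## Bernstein form and the bridge to (R1-same) -/

section Events

variable {V : Type*} {E : Type*}

/-- `{a₁ ↮ a₂}` is `R_{{a₂}}` at the root `a₁`. -/
lemma avoidAll_singleton_eq (ends : E → Sym2 V) (a₁ a₂ : V) :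
    avoidAll ends a₂ {a₁} = avoidAll ends a₁ {a₂} := by
  ext ω
  simp only [avoidAll, Set.mem_setOf_eq, Finset.mem_singleton, forall_eq]
  exact ⟨fun h hc => h (conn_symm hc), fun h hc => h (conn_symm hc)⟩

/-- `{b ∈ C(a₁)}` is `connAll a₁ {b}`. -/
lemma connEvent_eq_connAll (ends : E → Sym2 V) (a₁ b : V) :
    connEvent ends a₁ b = connAll ends a₁ {b} := by
  ext ω
  simp [connEvent, connAll]

end Events

section Bridge

variable {V : Type*} {E : Type*} [Fintype E] [DecidableEq E] [DecidableEq V] {R : Type*} [Field R]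
  [LinearOrder R] [IsStrictOrderedRing R]

omit [LinearOrder R] [IsStrictOrderedRing R] in
/-- The slack of (CC2) is `P^{X∪Y}_0 · c_mix − P^{X∪Y}_1 · c₀`. -/
lemma CC2_slack_eq (p : E → R) (ends : E → Sym2 V) (e : E) (s : V) (A B X Y : Finset V) :
    massF (Function.update p e 1) ends s (A ∪ B) (X ∩ Y) *
          massP (Function.update p e 0) ends s (X ∪ Y) ^ 2 +
        massF (Function.update p e 0) ends s A X * massF (Function.update p e 0) ends s B Y *
          massP (Function.update p e 1) ends s (X ∪ Y) -
      massP (Function.update p e 0) ends s (X ∪ Y) *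
        (massF (Function.update p e 1) ends s A X * massF (Function.update p e 0) ends s B Y +
          massF (Function.update p e 0) ends s A X * massF (Function.update p e 1) ends s B Y) =
      massP (Function.update p e 0) ends s (X ∪ Y) * cmix p ends e s A B X Y -
        massP (Function.update p e 1) ends s (X ∪ Y) * c0 p ends e s A B X Y := by
  unfold cmix c0
  ring

/-- **(CC2) in Bernstein form**: `P^{X∪Y}_1 · c₀ ≤ P^{X∪Y}_0 · c_mix` — the mixed base carries at least
the closed–closed BHK slack, per unit `R_{X∪Y}`-mass (mine-c's quantitative fibre-BHK). -/
theorem CC2_iff_bernstein (p : E → R) (ends : E → Sym2 V) (e : E) (s : V) (A B X Y : Finset V) :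
    CC2 p ends e s A B X Y ↔
      massP (Function.update p e 1) ends s (X ∪ Y) * c0 p ends e s A B X Y ≤
        massP (Function.update p e 0) ends s (X ∪ Y) * cmix p ends e s A B X Y := by
  unfold CC2
  rw [← sub_nonneg, CC2_slack_eq, sub_nonneg]

omit [LinearOrder R] [IsStrictOrderedRing R] in
/-- `massF` at the pair `{b}, {o}` is the same-cluster mass `A^s` of `R1Rung`. -/
lemma massF_pair (p : E → R) (ends : E → Sym2 V) (o a₁ a₂ b : V) :
    massF p ends a₁ ({b} ∪ {o}) ({a₂} ∩ {a₂}) = R1Rung.massAs p ends o a₁ a₂ b := by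
  unfold massF R1Rung.massAs
  rw [Finset.inter_self, avoidAll_singleton_eq]
  congr 1
  ext ω
  simp only [Set.mem_inter_iff, connAll, Set.mem_setOf_eq, Finset.mem_union, Finset.mem_singleton,
    connEvent]
  constructor
  · rintro ⟨hQ, h⟩
    exact ⟨hQ, h b (Or.inl rfl), h o (Or.inr rfl)⟩
  · rintro ⟨hQ, hb, ho⟩
    refine ⟨hQ, fun a ha => ?_⟩
    rcases ha with rfl | rfl
    · exact hb
    · exact ho

omit [DecidableEq V] [LinearOrder R] [IsStrictOrderedRing R] in
/-- `massF` at a singleton target `{x}` is `F = P(Q, x ∈ C(a₁))`. -/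
lemma massF_singleton (p : E → R) (ends : E → Sym2 V) (a₁ a₂ x : V) :
    massF p ends a₁ {x} {a₂} = R1Rung.massF p ends a₁ a₂ x := by
  unfold massF R1Rung.massF
  rw [avoidAll_singleton_eq, connEvent_eq_connAll]

omit [LinearOrder R] [IsStrictOrderedRing R] in
/-- `massP` at `{a₂}` is `P(Q)`. -/
lemma massP_eq (p : E → R) (ends : E → Sym2 V) (a₁ a₂ : V) :
    massP p ends a₁ ({a₂} ∪ {a₂}) = R1Rung.massQ p ends a₁ a₂ := by
  unfold massP R1Rung.massQ
  rw [Finset.union_self, avoidAll_singleton_eq]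

omit [DecidableEq V] [LinearOrder R] [IsStrictOrderedRing R] in
/-- `F^s = P(Q, o ∈ C(a₁))` is `F` at the target `o`. -/
lemma R1Rung_massFs_eq (p : E → R) (ends : E → Sym2 V) (o a₁ a₂ : V) :
    R1Rung.massFs p ends o a₁ a₂ = R1Rung.massF p ends a₁ a₂ o := rfl

omit [IsStrictOrderedRing R] in
/-- **(R1-same) is the instance of (CC2)** at `s = a₁`, `X = Y = {a₂}`, `A = {b}`, `B = {o}`. -/
theorem R1Same_iff_CC2 (p : E → R) (ends : E → Sym2 V) (e : E) (o a₁ a₂ b : V) :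
    R1Rung.R1Same p ends e o a₁ a₂ b ↔ CC2 p ends e a₁ {b} {o} {a₂} {a₂} := by
  unfold CC2 R1Rung.R1Same
  simp only [massF_pair, massF_singleton, massP_eq, R1Rung_massFs_eq]
  constructor <;> intro h <;> (ring_nf at h ⊢; exact h)

end Bridge

end TwoSetRung

end Summit.Ventures.PercRepro2
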